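import Literature.NumberTheory.LFunctions.GaussianHeckeConvexity
import Literature.NumberTheory.LFunctions.GaussianHeckeTauberian
import Literature.Analysis.Complex.LogDerivZeros
import HarnessLib

/-!
# `L'/L(s, λ^m)` near `σ = 1` for the Hecke `L`-functions of `ℚ(i)`: the Lemma-α package

Topic `Literature/NumberTheory/LFunctions`.  For `D_m = 4 L(·, λ^m)`
(`Literature.NumberTheory.LFunctions.GaussianHecke.heckeL`, `m ≥ 1`) we PROVE the three standard inputs of
Landau's bound for `D_m'/D_m` inside a zero-free region (Montgomery–Vaughan §6.2 / §11.1 for `ζ` and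
`L(s, χ)`; here for the Grössencharakter `L`-functions of `ℚ(i)`, uniformly in the frequency `m`):

* `exists_norm_heckeP_le` — the **trivial bound** `‖P_m(s)‖ ≤ 1/(σ - 1) + K₀` for `1 < σ ≤ 2`
  (`P_m = -D_m'/D_m = ∑ l_m(n) n^{-s}`, `|l_m(n)| ≤ l_0(n)`, and `P_0(σ) = 1/(σ-1) - H'/H(σ)` with
  `H = (s-1)D_0` entire and zero-free on `σ ≥ 1`);
* `inv_le_norm_heckeL_centre` — the **lower bound at the centres** `c = 17/16 + it`:
  `‖D_m(c)‖ ≥ B⁻¹`, `B = ∑_{z≠0} N(z)^{-17/16}`, from the `3-4-1` inequality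
  `‖D_0(σ)³ D_m(σ+it)⁴ D_{2m}(σ+2it)‖ ≥ 1` (`GaussianHeckeNonvanishing.lean`);
* `exists_logDeriv_package` — **Titchmarsh's Lemma α** on the discs `|z - c| ≤ 13/32`:
  `D_m'/D_m(z) = ∑_{a ∈ S} m(a)/(z - a) + ψ(z)` with `‖ψ(z)‖ ≤ E log(|t| + 2m + 5)` for
  `|z - c| ≤ 13/128`, `E` absolute (inputs: the convexity bound `‖D_m(z)‖ ≤ D(|Im z| + 2m + 4)²`,
  `GaussianHeckeConvexity.lean`, and the lower bound at `c`);
* `sum_mult_le` — the **total multiplicity** `∑_{a ∈ S} m(a) ≤ 8(8 + K₀ + E) ℒ²`, `ℒ = log(|t| + 2m + 5)`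
  (real parts at `s₁ = 1 + 1/(8ℒ) + it`, MV (11.11)).

## References

* H. L. Montgomery, R. C. Vaughan, *Multiplicative Number Theory I*, CUP 2007, Lemma 6.4, Lemma 11.1,
  Theorem 11.4 (proof, (11.11)). [MontgomeryVaughan2007]
* E. C. Titchmarsh, *The Theory of the Riemann Zeta-Function*, 2nd ed., §3.9 Lemma α. [Titchmarsh1986]
* G. Harman, *Prime-Detecting Sieves*, Princeton UP 2007, Lemma 11.6 (the consumer). [Harman2007]
-/

noncomputable section

open Complex Filter Topology Metric Set Finset

namespace Literature.NumberTheory.LFunctions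

namespace GaussianHecke

open GaussianInt

/-! ### The trivial bound `‖P_m(s)‖ ≤ 1/(σ-1) + K₀` -/

/-- `‖l_m(n)‖ ≤ l_0(n) = a⁰(n)` (`|λ^m(π)^j| = 1`). [folklore] -/
theorem norm_lCoeff_le_coeffZero (m n : ℕ) : ‖lCoeff m n‖ ≤ coeffZero n := by
  unfold lCoeff coeffZero
  refine (norm_sum_le _ _).trans (Finset.sum_le_sum fun p hp ↦ ?_)
  rw [norm_mul, Complex.norm_real, Real.norm_of_nonneg (log_norm_nonneg_of_mem hp),
    norm_angularChar_pow_of_mem m hp, mul_one]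

/-- `‖P_m(s)‖ ≤ ‖P_0(σ)‖` for `σ = Re s > 1` (termwise domination `|l_m(n) n^{-s}| ≤ l_0(n) n^{-σ}`,
the right side being a series of nonnegative reals). [folklore] -/
theorem norm_heckeP_le_norm_heckeP_zero (m : ℕ) {s : ℂ} (hs : 1 < s.re) :
    ‖heckeP m s‖ ≤ ‖heckeP 0 (s.re : ℂ)‖ := by
  have hσ : 1 < ((s.re : ℂ)).re := by rwa [ofReal_re]
  obtain ⟨hsum, hL⟩ := LSeries_coeffZero hσ
  set g : ℕ → ℝ := fun n ↦ ‖LSeries.term (fun n ↦ (coeffZero n : ℂ)) (s.re : ℂ) n‖ with hg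
  -- the terms `a⁰(n) n^{-σ}` are nonnegative reals
  have hterm : ∀ n, LSeries.term (fun n ↦ (coeffZero n : ℂ)) (s.re : ℂ) n = ((g n : ℝ) : ℂ) := by
    intro n
    simp only [hg]
    rcases eq_or_ne n 0 with rfl | hn
    · simp
    · rw [LSeries.term_of_ne_zero hn, norm_div, Complex.norm_real,
        Real.norm_of_nonneg (coeffZero_nonneg n),
        Complex.norm_natCast_cpow_of_pos (Nat.pos_of_ne_zero hn), ofReal_re]
      push_cast
      congr 1
      rw [Complex.ofReal_cpow (Nat.cast_nonneg n)]
      norm_cast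
  have hgsum : HasSum (fun n ↦ ((g n : ℝ) : ℂ)) (heckeP 0 (s.re : ℂ)) := by
    rw [← hL]
    exact (hsum.hasSum).congr_fun fun n ↦ (hterm n).symm
  have hgsum' : HasSum g ‖heckeP 0 (s.re : ℂ)‖ := by
    have h1 : HasSum g (heckeP 0 (s.re : ℂ)).re := by
      have := Complex.hasSum_re hgsum
      simpa using this
    have hnn : 0 ≤ (heckeP 0 (s.re : ℂ)).re :=
      h1.nonneg fun n ↦ norm_nonneg _
    have him : (heckeP 0 (s.re : ℂ)).im = 0 := by
      have h2 := Complex.hasSum_im hgsum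
      simp only [ofReal_im] at h2
      exact (hasSum_zero.unique h2).symm
    have hnorm : ‖heckeP 0 (s.re : ℂ)‖ = (heckeP 0 (s.re : ℂ)).re := by
      rw [← Complex.re_add_im (heckeP 0 (s.re : ℂ)), him]
      simp [abs_of_nonneg hnn]
    rwa [hnorm]
  -- domination
  unfold heckeP LSeries
  refine tsum_of_norm_bounded hgsum' fun n ↦ ?_
  simp only [hg]
  rcases eq_or_ne n 0 with rfl | hn
  · simp
  · rw [LSeries.term_of_ne_zero hn, LSeries.term_of_ne_zero hn, norm_div, norm_div,
      Complex.norm_natCast_cpow_of_pos (Nat.pos_of_ne_zero hn),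
      Complex.norm_natCast_cpow_of_pos (Nat.pos_of_ne_zero hn), ofReal_re, Complex.norm_real,
      Real.norm_of_nonneg (coeffZero_nonneg n)]
    exact div_le_div_of_nonneg_right (norm_lCoeff_le_coeffZero m n) (by positivity)


/-- **`-H'/H` is bounded on `[1, 2]`**: `K₀ = sup_{1 ≤ σ ≤ 2} ‖H'(σ)/H(σ)‖` exists (continuity of
`logDerivH` on `Re s ≥ 1` and compactness). [folklore] -/
theorem exists_norm_logDerivH_le :
    ∃ K₀ : ℝ, 0 ≤ K₀ ∧ ∀ σ : ℝ, 1 ≤ σ → σ ≤ 2 → ‖logDerivH (σ : ℂ)‖ ≤ K₀ := by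
  have hK : IsCompact (((↑) : ℝ → ℂ) '' Icc (1 : ℝ) 2) := isCompact_Icc.image continuous_ofReal
  have hsub : ((↑) : ℝ → ℂ) '' Icc (1 : ℝ) 2 ⊆ {s : ℂ | 1 ≤ s.re} := by
    rintro _ ⟨σ, hσ, rfl⟩
    simpa using hσ.1
  obtain ⟨C, hC⟩ := hK.exists_bound_of_continuousOn (continuousOn_logDerivH.mono hsub)
  refine ⟨max C 0, le_max_right _ _, fun σ h1 h2 ↦ (hC σ ⟨σ, ⟨h1, h2⟩, rfl⟩).trans (le_max_left _ _)⟩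

/-- **The trivial bound for `P_m`**: there is an absolute `K₀ ≥ 0` with
`‖P_m(s)‖ ≤ 1/(σ - 1) + K₀` for all `m` and `1 < σ = Re s ≤ 2`
(`‖P_m(s)‖ ≤ P_0(σ) = 1/(σ-1) - H'/H(σ)`). [cite: MontgomeryVaughan2007, Lemma 6.4 (proof)] -/
theorem exists_norm_heckeP_le :
    ∃ K₀ : ℝ, 0 ≤ K₀ ∧ ∀ (m : ℕ) (s : ℂ), 1 < s.re → s.re ≤ 2 → ‖heckeP m s‖ ≤ 1 / (s.re - 1) + K₀ := by
  obtain ⟨K₀, hK₀, hK⟩ := exists_norm_logDerivH_le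
  refine ⟨K₀, hK₀, fun m s hs hs2 ↦ (norm_heckeP_le_norm_heckeP_zero m hs).trans ?_⟩
  have hσ : 1 < ((s.re : ℂ)).re := by rwa [ofReal_re]
  rw [heckeP_zero_eq hσ]
  refine (norm_add_le _ _).trans ?_
  have h1 : ‖(1 : ℂ) / ((s.re : ℂ) - 1)‖ = 1 / (s.re - 1) := by
    rw [show ((s.re : ℂ) - 1) = ((s.re - 1 : ℝ) : ℂ) by push_cast; ring, norm_div, norm_one,
      Complex.norm_real, Real.norm_of_nonneg (by linarith)]
  rw [h1, add_comm]
  gcongr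
  exact hK s.re hs.le hs2

/-- `‖D_m'(s)/D_m(s)‖ = ‖P_m(s)‖ for `Re s > 1`. [folklore] -/
theorem norm_deriv_div_eq (m : ℕ) {s : ℂ} (hs : 1 < s.re) :
    ‖deriv (heckeL m) s / heckeL m s‖ = ‖heckeP m s‖ := by
  rw [heckeP_eq_neg_deriv_div m hs, neg_div, norm_neg]

/-! ### The lower bound at the centres `17/16 + it` -/

/-- **`‖D_m(17/16 + it)‖ ≥ B⁻¹`**, `B = ∑_{z ≠ 0} N(z)^{-17/16}`, for every `m` and real `t`: from
`1 ≤ ‖D_0(17/16)³ D_m(17/16+it)⁴ D_{2m}(17/16+2it)‖ ≤ (B ‖D_m(17/16+it)‖)⁴`. [cite: HeckeMathZ1920, §7] -/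
theorem inv_le_norm_heckeL_centre (m : ℕ) (t : ℝ) :
    (∑' x : GaussianInt, ((x.norm : ℤ) : ℝ) ^ (-(17 / 16 : ℝ)))⁻¹ ≤ ‖heckeL m (17 / 16 + t * I)‖ := by
  set B : ℝ := ∑' x : GaussianInt, ((x.norm : ℤ) : ℝ) ^ (-(17 / 16 : ℝ)) with hB
  have hB1 : 1 ≤ B := one_le_normSum (by norm_num)
  have hB0 : 0 < B := by linarith
  set L : ℝ := ‖heckeL m (17 / 16 + t * I)‖ with hL
  have hprod := one_le_norm_heckeL_product m (x := 1 / 16) (by norm_num) t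
  have e1 : (1 : ℂ) + ((1 / 16 : ℝ) : ℂ) = (((17 / 16 : ℝ)) : ℂ) := by push_cast; norm_num
  have e2 : (1 : ℂ) + ((1 / 16 : ℝ) : ℂ) + I * t = 17 / 16 + t * I := by push_cast; ring
  have e3 : (1 : ℂ) + ((1 / 16 : ℝ) : ℂ) + 2 * I * t = (((17 / 16 : ℝ)) : ℂ) + ((2 * t : ℝ) : ℂ) * I := by
    push_cast; ring
  rw [e2, e3, e1, norm_mul, norm_mul, norm_pow, norm_pow, ← hL] at hprod
  have hb0 : ‖heckeL 0 (((17 / 16 : ℝ)) : ℂ)‖ ≤ B := by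
    have hre : ((((17 / 16 : ℝ)) : ℂ)).re = 17 / 16 := ofReal_re _
    have := norm_heckeL_le_normSum 0 (s := (((17 / 16 : ℝ)) : ℂ)) (by rw [hre]; norm_num)
    rwa [hre] at this
  have hb2 : ‖heckeL (2 * m) ((((17 / 16 : ℝ)) : ℂ) + ((2 * t : ℝ) : ℂ) * I)‖ ≤ B := by
    have hre : ((((17 / 16 : ℝ)) : ℂ) + ((2 * t : ℝ) : ℂ) * I).re = 17 / 16 := by simp
    have := norm_heckeL_le_normSum (2 * m) (s := (((17 / 16 : ℝ)) : ℂ) + ((2 * t : ℝ) : ℂ) * I)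
      (by rw [hre]; norm_num)
    rwa [hre] at this
  have hL0 : 0 ≤ L := norm_nonneg _
  have h4 : 1 ≤ (B * L) ^ 4 := by
    calc (1 : ℝ) ≤ ‖heckeL 0 (((17 / 16 : ℝ)) : ℂ)‖ ^ 3 * L ^ 4 *
          ‖heckeL (2 * m) ((((17 / 16 : ℝ)) : ℂ) + ((2 * t : ℝ) : ℂ) * I)‖ := hprod
      _ ≤ B ^ 3 * L ^ 4 * B := by gcongr
      _ = (B * L) ^ 4 := by ring
  have hBL : 1 ≤ B * L := by
    by_contra h
    rw [not_le] at h
    have := pow_lt_one₀ (by positivity : 0 ≤ B * L) h (by norm_num : (4 : ℕ) ≠ 0)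
    linarith
  rw [inv_le_iff_one_le_mul₀ hB0]
  linarith [mul_comm B L]

/-! ### Titchmarsh's Lemma α on the discs `|z - (17/16 + it)| ≤ 13/32` -/

/-- `1 ≤ log(|t| + 2m + 5)` for `m ≥ 1` (`|t| + 2m + 5 ≥ 7 > e`). [folklore] -/
theorem one_le_ell {m : ℕ} (hm : m ≠ 0) (t : ℝ) : 1 ≤ Real.log (|t| + 2 * m + 5) := by
  have hm1 : (1 : ℝ) ≤ m := by exact_mod_cast Nat.one_le_iff_ne_zero.mpr hm
  rw [Real.le_log_iff_exp_le (by positivity)]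
  have := Real.exp_one_lt_d9
  linarith [abs_nonneg t]

/-- **Montgomery–Vaughan Lemma 11.1 for `D_m = 4L(·, λ^m)`, `m ≥ 1`** (Titchmarsh's Lemma α,
`Literature.Analysis.Complex.titchmarsh_logDeriv_sub_sum`, on the discs centred at `c = 17/16 + it`,
`R = 13/32`): there is an absolute `E` such that for every `m ≥ 1` and real `t` the zeros of `D_m` in
`|a - c| ≤ 13/32` form a finite set `S` with multiplicities `mult ≥ 1`, and
`D_m'/D_m(z) = ∑_{a ∈ S} mult(a)/(z - a) + ψ(z)` on `|z - c| < 13/32` (off the zeros) with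
`‖ψ(z)‖ ≤ E log(|t| + 2m + 5)` for `|z - c| ≤ 13/128`.  Inputs: `‖D_m(z)‖ ≤ D(|t| + 2m + 5)²` on
`|z - c| ≤ 13/16` (`norm_heckeL_le_mul_sq'`) and `‖D_m(c)‖ ≥ B⁻¹` (`inv_le_norm_heckeL_centre`), so that
`log(M/‖D_m(c)‖) ≤ log(DB) + 2 log(|t| + 2m + 5)`. [cite: MontgomeryVaughan2007, Lemma 11.1] -/
theorem exists_logDeriv_package :
    ∃ E : ℝ, 0 ≤ E ∧ ∀ (m : ℕ), m ≠ 0 → ∀ t : ℝ,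
      ∃ (S : Finset ℂ) (mult : ℂ → ℕ) (ψ : ℂ → ℂ),
        (∀ a ∈ S, heckeL m a = 0 ∧ 0 < mult a ∧ ‖a - (17 / 16 + t * I)‖ ≤ 13 / 32) ∧
        (∀ a, heckeL m a = 0 → ‖a - (17 / 16 + t * I)‖ ≤ 13 / 32 → a ∈ S) ∧
        (∀ z ∈ ball (17 / 16 + t * I) (13 / 32), heckeL m z ≠ 0 →
          ψ z = deriv (heckeL m) z / heckeL m z - ∑ a ∈ S, (mult a : ℂ) / (z - a)) ∧
        (∀ z ∈ closedBall (17 / 16 + t * I) (13 / 128),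
          ‖ψ z‖ ≤ E * Real.log (|t| + 2 * m + 5)) := by
  set D : ℝ := ∑' x : GaussianInt, ((x.norm : ℤ) : ℝ) ^ (-(3 / 2 : ℝ)) with hDdef
  set B : ℝ := ∑' x : GaussianInt, ((x.norm : ℤ) : ℝ) ^ (-(17 / 16 : ℝ)) with hBdef
  have hD1 : 1 ≤ D := one_le_normSum (by norm_num)
  have hB1 : 1 ≤ B := one_le_normSum (by norm_num)
  have hDB : 0 ≤ Real.log (D * B) := Real.log_nonneg (one_le_mul_of_one_le_of_one_le hD1 hB1)
  set R : ℝ := 13 / 32 with hR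
  have hRpos : 0 < R := by norm_num
  refine ⟨8 * (Real.log (D * B) + 3) / R, by positivity, fun m hm t ↦ ?_⟩
  have hm1 : (1 : ℝ) ≤ m := by exact_mod_cast Nat.one_le_iff_ne_zero.mpr hm
  set c : ℂ := 17 / 16 + t * I with hcdef
  have hcre : c.re = 17 / 16 := by simp [hcdef]
  have hcim : c.im = t := by simp [hcdef]
  -- the bound `M` on the disc `|z - c| ≤ 2R = 13/16`
  set M : ℝ := D * (|t| + 2 * m + 5) ^ 2 with hMdef
  have hM : ∀ z ∈ closedBall c (2 * R), ‖heckeL m z‖ ≤ M := by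
    intro z hz
    rw [mem_closedBall, dist_eq_norm] at hz
    have hre : |(z - c).re| ≤ ‖z - c‖ := Complex.abs_re_le_norm _
    have him : |(z - c).im| ≤ ‖z - c‖ := Complex.abs_im_le_norm _
    simp only [Complex.sub_re, hcre, Complex.sub_im, hcim] at hre him
    rw [hR] at hz
    have hzre : -1 / 2 ≤ z.re := by
      have := neg_abs_le (z.re - 17 / 16); linarith
    have hzre3 : z.re ≤ 3 := by
      have := le_abs_self (z.re - 17 / 16); linarith
    have hzim : |z.im| ≤ |t| + 13 / 16 := by
      have := abs_sub_abs_le_abs_sub z.im t; linarith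
    calc ‖heckeL m z‖ ≤ D * (|z.im| + 2 * m + 4) ^ 2 := norm_heckeL_le_mul_sq' hm hzre hzre3
      _ ≤ D * (|t| + 2 * m + 5) ^ 2 := by
          have h1 : |z.im| + 2 * m + 4 ≤ |t| + 2 * m + 5 := by linarith
          have h0 : 0 ≤ |z.im| + 2 * m + 4 := by positivity
          exact mul_le_mul_of_nonneg_left (pow_le_pow_left₀ h0 h1 2) (by linarith)
  -- the lower bound at the centre
  have hlow : B⁻¹ ≤ ‖heckeL m c‖ := inv_le_norm_heckeL_centre m t
  have hBpos : 0 < B := by linarith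
  have hc0 : heckeL m c ≠ 0 := by
    intro h; rw [h, norm_zero] at hlow
    exact absurd hlow (not_le.mpr (inv_pos.mpr hBpos))
  obtain ⟨S, mult, ψ, hS, hS', -, hψ, hψb, -⟩ :=
    Literature.Analysis.Complex.titchmarsh_logDeriv_sub_sum (differentiable_heckeL hm) hc0 hRpos hM
  refine ⟨S, mult, ψ, hS, hS', hψ, fun z hz ↦ (hψb z (by rw [hR]; convert hz using 2; norm_num)).trans ?_⟩
  -- `log(M/‖D_m(c)‖) ≤ log(DB) + 2 log(|t| + 2m + 5)`
  have hℓ := one_le_ell hm t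
  set ℓ : ℝ := Real.log (|t| + 2 * m + 5) with hℓdef
  have hbase : (1 : ℝ) ≤ |t| + 2 * m + 5 := by linarith [abs_nonneg t]
  have hMpos : 0 < M := by positivity
  have hlog : Real.log (M / ‖heckeL m c‖) ≤ Real.log (D * B) + 2 * ℓ := by
    have hpos : 0 < ‖heckeL m c‖ := lt_of_lt_of_le (inv_pos.mpr hBpos) hlow
    have h1 : M / ‖heckeL m c‖ ≤ M * B := by
      rw [div_le_iff₀ hpos]
      calc M = M * (B * B⁻¹) := by rw [mul_inv_cancel₀ hBpos.ne', mul_one]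
        _ = M * B * B⁻¹ := by ring
        _ ≤ M * B * ‖heckeL m c‖ := by gcongr
    calc Real.log (M / ‖heckeL m c‖) ≤ Real.log (M * B) := Real.log_le_log (by positivity) h1
      _ = Real.log (D * B) + 2 * ℓ := by
          rw [hMdef, show D * (|t| + 2 * m + 5) ^ 2 * B = (D * B) * (|t| + 2 * m + 5) ^ 2 by ring,
            Real.log_mul (by positivity) (by positivity), Real.log_pow, hℓdef]
          push_cast
          ring
  rw [div_mul_eq_mul_div, hR, div_le_div_iff_of_pos_right (by norm_num : (0:ℝ) < 13 / 32)]
  have h2 : Real.log (D * B) ≤ Real.log (D * B) * ℓ := by nlinarith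
  nlinarith

/-! ### The total multiplicity in the disc -/

/-- **Total multiplicity of the zeros of `D_m` in the Lemma-α disc** (MV (11.11) for `λ^m`): with the
package at height `t`, `ℒ = log(|t| + 2m + 5)` and `s₁ = 1 + 1/(8ℒ) + it`,
`∑_{a ∈ S} mult(a) ≤ 8(8 + K₀ + E)ℒ²`, because `Re ∑ mult(a)/(s₁ - a) = Re D_m'/D_m(s₁) - Re ψ(s₁) ≤
(8ℒ + K₀) + Eℒ` and `Re 1/(s₁ - a) ≥ σ₁ - 1 = 1/(8ℒ)` (`Re a < 1`, `|s₁ - a| ≤ 1`).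
[cite: MontgomeryVaughan2007, Theorem 11.4 (proof, eq. (11.11))] -/
theorem sum_mult_le {m : ℕ} (hm : m ≠ 0) {K₀ E : ℝ} (hK₀ : 0 ≤ K₀)
    (hK : ∀ (m : ℕ) (s : ℂ), 1 < s.re → s.re ≤ 2 → ‖heckeP m s‖ ≤ 1 / (s.re - 1) + K₀)
    {t : ℝ} {S : Finset ℂ} {mult : ℂ → ℕ} {ψ : ℂ → ℂ}
    (hS : ∀ a ∈ S, heckeL m a = 0 ∧ 0 < mult a ∧ ‖a - (17 / 16 + t * I)‖ ≤ 13 / 32)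
    (hψ : ∀ z ∈ ball (17 / 16 + t * I) (13 / 32), heckeL m z ≠ 0 →
      ψ z = deriv (heckeL m) z / heckeL m z - ∑ a ∈ S, (mult a : ℂ) / (z - a))
    (hψb : ∀ z ∈ closedBall (17 / 16 + t * I) (13 / 128),
      ‖ψ z‖ ≤ E * Real.log (|t| + 2 * m + 5)) :
    (∑ a ∈ S, (mult a : ℝ)) ≤ 8 * (8 + K₀ + E) * Real.log (|t| + 2 * m + 5) ^ 2 := by
  set ℒ : ℝ := Real.log (|t| + 2 * m + 5) with hℒ
  have hℒ1 : 1 ≤ ℒ := one_le_ell hm t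
  have hℒ0 : 0 < ℒ := by linarith
  set σ₁ : ℝ := 1 + 1 / (8 * ℒ) with hσ₁
  have hκ : 0 < 1 / (8 * ℒ) := by positivity
  have hκ1 : 1 / (8 * ℒ) ≤ 1 / 8 := by
    rw [div_le_div_iff₀ (by positivity) (by norm_num)]; linarith
  obtain ⟨s₁, hs₁⟩ : ∃ s₁ : ℂ, s₁ = (σ₁ : ℂ) + t * I := ⟨_, rfl⟩
  have hs₁re : s₁.re = σ₁ := by simp [hs₁]
  have hs₁1 : 1 < s₁.re := by rw [hs₁re, hσ₁]; linarith
  have hs₁2 : s₁.re ≤ 2 := by rw [hs₁re, hσ₁]; linarith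
  set c : ℂ := 17 / 16 + t * I with hcdef
  have hs₁c : ‖s₁ - c‖ ≤ 13 / 128 := by
    have : s₁ - c = ((1 / (8 * ℒ) - 1 / 16 : ℝ) : ℂ) := by
      simp only [hs₁, hcdef, hσ₁]; push_cast; ring
    rw [this, Complex.norm_real, Real.norm_eq_abs, abs_le]
    constructor <;> linarith
  have hs₁ball : s₁ ∈ ball c (13 / 32) := mem_ball_iff_norm.2 (by linarith)
  have hs₁cl : s₁ ∈ closedBall c (13 / 128) := mem_closedBall_iff_norm.2 hs₁c
  have hL₁ : heckeL m s₁ ≠ 0 := heckeL_ne_zero_of_one_le_re hm hs₁1.le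
  have hψ₁ := hψ s₁ hs₁ball hL₁
  -- `Re ∑ ≤ (8 + K₀ + E) ℒ`
  have hbound : (∑ a ∈ S, (mult a : ℂ) / (s₁ - a)).re ≤ (8 + K₀ + E) * ℒ := by
    have hEq : ∑ a ∈ S, (mult a : ℂ) / (s₁ - a) = deriv (heckeL m) s₁ / heckeL m s₁ - ψ s₁ := by
      rw [hψ₁]; ring
    rw [hEq, Complex.sub_re]
    have h1 : ‖deriv (heckeL m) s₁ / heckeL m s₁‖ ≤ 8 * ℒ + K₀ := by
      have := hK m s₁ hs₁1 hs₁2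
      rw [norm_deriv_div_eq m hs₁1]
      rw [hs₁re, hσ₁, show 1 + 1 / (8 * ℒ) - 1 = 1 / (8 * ℒ) by ring, one_div_one_div] at this
      exact this
    have h2 := hψb s₁ hs₁cl
    have h3 := Complex.abs_re_le_norm (deriv (heckeL m) s₁ / heckeL m s₁)
    have h4 := Complex.abs_re_le_norm (ψ s₁)
    have hK₀ℒ : K₀ ≤ K₀ * ℒ := by nlinarith
    rw [abs_le] at h3 h4
    nlinarith [h3.2, h4.1]
  -- each term: `mult(a) (σ₁ − 1) ≤ Re (mult(a)/(s₁ − a))`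
  have hterm : ∀ a ∈ S, (mult a : ℝ) * (1 / (8 * ℒ)) ≤ ((mult a : ℂ) / (s₁ - a)).re := by
    intro a ha
    obtain ⟨hLa, -, hac⟩ := hS a ha
    have hare : a.re < 1 := by
      by_contra hcon
      exact heckeL_ne_zero_of_one_le_re hm (not_lt.1 hcon) hLa
    have hn : ‖s₁ - a‖ ≤ 1 := by
      calc ‖s₁ - a‖ = ‖(s₁ - c) + (c - a)‖ := by ring_nf
        _ ≤ ‖s₁ - c‖ + ‖c - a‖ := norm_add_le _ _
        _ ≤ 13 / 128 + 13 / 32 := by rw [norm_sub_rev c a]; exact add_le_add hs₁c hac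
        _ ≤ 1 := by norm_num
    have hre0 : 1 / (8 * ℒ) ≤ (s₁ - a).re := by
      simp only [Complex.sub_re, hs₁re, hσ₁]; linarith
    -- `Re (1/w) ≥ Re w` for `w = s₁ - a`, `‖w‖ ≤ 1`, `Re w ≥ 0` (as `DirichletZFR.re_le_re_inv`)
    have hinv : (s₁ - a).re ≤ ((s₁ - a)⁻¹).re := by
      have hw0 : s₁ - a ≠ 0 := fun h ↦ by
        have := congrArg Complex.re h
        simp only [Complex.sub_re, Complex.zero_re] at this
        simp only [Complex.sub_re] at hre0
        linarith
      rw [Complex.inv_re, Complex.normSq_eq_norm_sq]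
      have hpos : 0 < ‖s₁ - a‖ ^ 2 := by positivity
      rw [le_div_iff₀ hpos]
      have h1 : ‖s₁ - a‖ ^ 2 ≤ 1 := pow_le_one₀ (norm_nonneg _) hn
      have h2 : 0 ≤ (s₁ - a).re := by linarith
      nlinarith
    have hre : ((mult a : ℂ) / (s₁ - a)).re = (mult a : ℝ) * ((s₁ - a)⁻¹).re := by
      rw [div_eq_mul_inv, show ((mult a : ℕ) : ℂ) = ((mult a : ℝ) : ℂ) by simp, Complex.re_ofReal_mul]
    rw [hre]
    exact mul_le_mul_of_nonneg_left (hre0.trans hinv) (Nat.cast_nonneg _)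
  have hsum : (∑ a ∈ S, (mult a : ℝ)) * (1 / (8 * ℒ)) ≤ (8 + K₀ + E) * ℒ := by
    rw [Finset.sum_mul]
    refine le_trans ?_ hbound
    rw [Complex.re_sum]
    exact Finset.sum_le_sum hterm
  rw [mul_one_div, div_le_iff₀ (by positivity)] at hsum
  have : (8 + K₀ + E) * ℒ * (8 * ℒ) = 8 * (8 + K₀ + E) * ℒ ^ 2 := by ring
  linarith

end GaussianHecke

end Literature.NumberTheory.LFunctions
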